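import Mathlib
import Summits.NavierStokesRegularity.NavierStokesRegularity.Theorems.TaoLadderRungTwoFlatTubeStepSplit
import Summits.NavierStokesRegularity.NavierStokesRegularity.Theorems.TaoLadderRungTwoFlatTubeBlock
import HarnessLib

/-!
# THE TUBE HOP `n > N₀` FROM A CONDITIONAL CORE-BLOCK ENCLOSURE, IN ONE CALL
  (helper for the K_A♭ parent item stmt-NavierStokesRegularity-22987 `FlatGapCertificatesV2`, child 2A, route TaoLadderRungTwoFlat;
  cell harvest/h2-tao-ladder, p1 g25; W-34 / A70-3: the row list theory-1's tube-phase enclosure fills)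

* `tubePhase_of_block` — `TubeStepClockWith ∧ TubeStepEnvelopeWith ∧ TubeStepLandWith` of the split R54 tube at the choice rule, hop
  `n > N₀`, = `tubeStep_of_schedule_split` (…TubeStepSplit, reference family the CO-SCALED pulse flow `W_z = scaleFam (anchorScale P i₀ z) U`)
  with its five flow-dependent inputs PRODUCED from ONE conditional core-block row (…TubeBlock / …TubeBlockFlow): `hcore2` (`ρ₂ := D_{2−K}`),
  `hwinA`, `hVt` (`tubeRows_of_conditionalBlock`), the carrier lower bound `hcarrier` (row `A_*(1−γ(n+1))f + D₁ ≤ |W_z(i₀,1)|`) and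
  the window hulls `hhull` (rows `M^W_k + D_k ≤ H_k`) from the block deviation (`tubeBlock_closure`). What remains booked: the pulse flow
  `U` and its template bounds (child 1), the conditional block row and the core landing contract `hland` (E2), the reference-only rows
  `hRT`, `hRW`, `hrefC`, `hrefV`, `hrefA`, `hMW`, and the scalar rows.

HONEST FRAMING: composition over the cell's typed frame (MODEL lattice); nothing certified; no item closed; nothing about the
Navier–Stokes equations.
-/

noncomputable section

-- the sub-problem namespace repeats the summit name by design (D-0017)
set_option linter.dupNamespace false

namespace Summit.NavierStokesRegularity.NavierStokesRegularity.Theorems.HopTube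

open Set Finset Filter Topology Literature.Analysis.FluidPDE Literature.Analysis.FluidPDE.TaoCascade MirrorPulse RenormFrame QuadPolar
  GappedFrontRobustOn FlowSymmetry

section Step

variable {ε ε₀ : ℝ}

set_option maxHeartbeats 1600000 in
/-- **THE TUBE HOP FROM A CONDITIONAL CORE-BLOCK ENCLOSURE.** See the module docstring.
[cite: Tao2016AveragedNS, §4 (4.1)–(4.10), §5, §6.2 Prop. 6.3 (ix), §6.3–6.4 Props. 6.4–6.5 (statement shape of the inductive step); cell LADDER §50, §59–§66, §70 (A70-3, W-34); route TaoLadderRungTwoFlat] -/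
theorem tubePhase_of_block (P : TubeSchedule) {θ' : ℝ} {Wb : ℕ → ℝ} {δs : ℕ → ℝ} {i₀ : Fin 2}
    {X₀ : Fin 2 → ℝ} {w : ℤ → ℝ} {σ r θ₀ c₀ t₀ τU : ℝ} {ζ : ℕ → Fin 2 → ℤ → ℝ} {ustar : Fin 2 → ℤ → ℝ}
    {good : ℕ → (Fin 2 → ℤ → ℝ → ℝ) → ℝ → Prop} {n : ℕ} {U FU : Fin 2 → ℤ → ℝ → ℝ}
    -- the pulse flow (child 1): one exact zero-slack flow of `u⋆` on `[0, τ_U] ⊇ [0, c₀]`, and its template bounds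
    (hU : PseudoFlowOnShift shiftSetFlat τU ε₀ (mirrorTable ε ε) 0 0 ustar (fun i k => (1 / 2) * ustar i k ^ 2) (fun _ _ => 0) U FU)
    (hc₀ : 0 < c₀) (hc₀U : c₀ ≤ τU)
    {M M₁ M₂ : ℝ}
    (hMU : ∀ s ∈ Icc 0 c₀, ∀ i, ∀ m ∈ Finset.Icc (-(P.D : ℤ)) (1 - (P.K : ℤ)), |U i m s| ≤ M)
    (hM₁U : ∀ s ∈ Icc 0 c₀, |U 1 (-(P.K : ℤ)) s| ≤ M₁) (hM₂U : ∀ s ∈ Icc 0 c₀, |U 0 (2 - (P.K : ℤ)) s| ≤ M₂)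
    -- statics
    (hε : 0 ≤ ε) (hε₀ : 0 < ε₀) (hn : P.N₀ < n) (hK : 1 ≤ P.K) (hDK : P.K + 1 ≤ P.D) (hθV : 0 < P.θV)
    (hθ : 0 < θ') (hθ5 : θ' ≤ 5 * Real.log (1 + ε₀)) (hw1 : ∀ k, 1 ≤ w k) (hr0 : 0 ≤ r)
    (hAstar : 0 < P.Astar) (hg : 0 < P.g) (hb : 0 < P.b) {ωK ω₁ MuK : ℝ} (hωK : 0 < ωK)
    (hωKle : ∀ i, ωK ≤ MirrorPulse.geomGauge P.g P.b i (-(P.K : ℤ))) (hMuK : ∀ i, |ustar i (-(P.K : ℤ))| ≤ MuK)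
    (hω₁ : 0 < ω₁) (hω₁le : ∀ i, ω₁ ≤ MirrorPulse.geomGauge P.g P.b i (1 - (P.K : ℤ)))
    (hWbn : 0 ≤ Wb n) (hWbn1 : 0 ≤ Wb (n + 1)) (hvn1 : 0 ≤ P.v (n + 1)) (hδn1 : 0 ≤ P.δ (n + 1))
    (hγn : P.γ n < 1) (hγ : 0 ≤ P.γ (n + 1)) (hθ₀ : 0 ≤ θ₀) (hθ₀1 : θ₀ ≤ 1) (hAFL : 0 < 1 - θ₀ * ε₀)
    (hσ : 0 ≤ σ) (hσγ : 1 + σ ≤ P.Astar * (1 - P.γ (n + 1)))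
    -- good section times exist and lie in the clock window (E2)
    {tlo : ℝ} (htlo : 0 < tlo)
    (hex : ∀ z S₀ τ S F, HopPremiseWith P (splitBcl P (behindR54 P θ' Wb) δs i₀ ustar) shiftSetFlat ε₀ i₀ (mirrorTable ε ε) X₀ w r c₀ ζ
      ustar n z S₀ τ S F → ∃ t, good n S t)
    (hwin : ∀ z S₀ τ S F, HopPremiseWith P (splitBcl P (behindR54 P θ' Wb) δs i₀ ustar) shiftSetFlat ε₀ i₀ (mirrorTable ε ε) X₀ w r c₀ ζ
      ustar n z S₀ τ S F → ∀ t, good n S t → tlo ≤ t ∧ t ≤ c₀)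
    -- NEAR/BEHIND (interface loop of record): deeper core input (E2), interface levels, rows
    {Aeff A A₀ A₁ rI RBAR BBAR RHO2 rs I₁ I₂ PUMP μN μB VbarN VbarB RT V₀N V₀B EN : ℝ}
    (hAeff : 0 < Aeff) (hrs : r + δs n / ω₁ ≤ rs) (hρ0 : 0 ≤ RHO2)
    (hRB0 : 0 < RBAR) (hBB0 : 0 < BBAR) (hRr : RBAR ≤ rI) (hBr : BBAR ≤ rI) (hVN0 : 0 ≤ VbarN)
    (hI₁0 : 0 ≤ I₁) (hI₂0 : 0 ≤ I₂)
    (hI₁ : 2 * (Real.exp (P.θV / 2) - 1) ≤ I₁ * P.θV) (hI₂ : Real.exp P.θV - 1 ≤ I₂ * P.θV)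
    (hPUMPdef : PUMP = 1 * c₀ * ((2 + ε) * M * I₁ * Real.sqrt (2 * VbarN) + 2 * I₂ * VbarN))
    (hlevC : rs + PUMP + 1 * c₀ * ((ε * (M + I₁ * Real.sqrt (2 * VbarN)) + ε * M + ε * BBAR) * RBAR
      + (2 + ε) * M * BBAR + BBAR ^ 2) < RBAR)
    (hlevV : rs + 1 * c₀ * ((M + M₂ + RBAR + RHO2) * BBAR + (1 + 2 * ε) * M * RBAR + ε * RBAR ^ 2
      + (M + 2 * ε * M₂) * RHO2 + ε * RHO2 ^ 2) < BBAR)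
    (hRT : ∀ z S₀ τ S F, HopPremiseWith P (splitBcl P (behindR54 P θ' Wb) δs i₀ ustar) shiftSetFlat ε₀ i₀ (mirrorTable ε ε) X₀ w r c₀ ζ
      ustar n z S₀ τ S F → ∀ t, good n S t →
        ∑ k ∈ Finset.Icc (-(P.D : ℤ)) (-(P.K : ℤ) - 1), Real.exp (P.θV * ((k : ℝ) + P.K)) *
          ∑ i : Fin 2, (scaleFam (anchorScale P i₀ z) U i (1 + k) t - |S i₀ 1 t| / P.Astar * ustar i k) ^ 2 / 2 ≤ RT)
    (hAdef : A = Real.sqrt (2 * VbarB) * Real.exp (θ' / 2) * Real.exp (θ' * ((P.D : ℝ) - P.K) / 2) + M)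
    (hA₀def : A₀ = M + rI) (hA₁def : A₁ = M₁ + Real.sqrt (2 * VbarN) * Real.exp (P.θV / 2))
    (hrA : rI ≤ A) (hA₀le : A₀ ≤ Aeff)
    (hV₀Ndef : V₀N = (Real.sqrt (P.v n + (P.δ n / ωK) ^ 2) + Real.sqrt P.D * r) ^ 2)
    (hV₀Bdef : V₀B = (Real.sqrt (Wb n + (MuK + P.δ n / ωK) ^ 2) + r / Real.sqrt (1 - Real.exp (-θ'))) ^ 2)
    (hENdef : EN = Real.exp (P.θV * ((1 : ℝ) - P.D + P.K)) * ((1 + ε) * 1 * A ^ 2 * (A + M))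
      + 1 * rI * (2 * VbarN + ε * rI * Real.sqrt (2 * VbarN) + (1 + ε) * M * rI))
    (hμN : 0 < μN)
    (hμNle : μN ≤ (1 / c₀) * P.θV - 2 * (1 + ε) * 1 * (A * Real.sinh (P.θV / 2) + M * (3 + Real.exp P.θV)))
    (hμB : 0 < μB) (hμBle : μB ≤ (1 / c₀) * θ' - 2 * (1 + ε) * Aeff * Real.sinh (θ' / 2))
    (hlevN : V₀N + EN * c₀ < VbarN) (hlevB : V₀B + A₁ * A₀ * (A₁ + ε * A₀) * c₀ < VbarB)
    (hclose : Real.sqrt (2 * VbarB) * Real.exp (θ' / 2) ≤ Aeff)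
    (hbudgetN : ∀ t ∈ Icc tlo c₀, (Real.sqrt (Real.exp (-μN * t) * V₀N + EN * (1 - Real.exp (-μN * t)) / μN)
      + Real.sqrt RT) ^ 2 ≤ (1 - θ₀ * ε₀) ^ 2 * P.v (n + 1))
    (hbudgetB : ∀ t ∈ Icc tlo c₀, Real.exp (-μB * t) * V₀B + A₁ * A₀ * (A₁ + ε * A₀) * (1 - Real.exp (-μB * t)) / μB
      ≤ (1 - θ₀ * ε₀) ^ 2 * Wb (n + 1))
    -- CORE (sharp rows): the landing contract (E2) against the co-scaled pulse flow, at the interface levels; row P-62a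
    {lev KF : Fin 2 → ℝ} {RHOC KQ DJ KI RW : ℝ} (hlev0 : RBAR ≤ lev 0) (hlev1 : BBAR ≤ lev 1)
    (hland : CoreLandingFromZ P (splitBcl P (behindR54 P θ' Wb) δs i₀ ustar) shiftSetFlat ε₀ i₀ (mirrorTable ε ε) X₀ w r c₀ ζ
      ustar good (fun z => scaleFam (anchorScale P i₀ z) U) n lev (LandingLevel RHOC KQ DJ KI (δs n) KF lev))
    (hδs : 0 ≤ δs (n + 1)) (hle : δs (n + 1) ≤ P.δ (n + 1))
    (hcoreland : RHOC * (δs n + KI) + (KF 0 * lev 0 + KF 1 * lev 1) + KQ * (δs n + KI) ^ 2 + DJ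
      ≤ (1 - θ₀ * ε₀) * δs (n + 1))
    -- CORE (wake row k = −K): the co-scaled pulse flow's own wake residual (E2, reference-only) and the row `hwake`
    (hRW : ∀ z S₀ τ S F, HopPremiseWith P (splitBcl P (behindR54 P θ' Wb) δs i₀ ustar) shiftSetFlat ε₀ i₀ (mirrorTable ε ε)
      X₀ w r c₀ ζ ustar n z S₀ τ S F → ∀ t, good n S t →
        ∀ i, |scaleFam (anchorScale P i₀ z) U i (1 - (P.K : ℤ)) t - |S i₀ 1 t| / P.Astar * ustar i (-(P.K : ℤ))| ≤ RW)
    (hwake : ∀ i, geomGauge P.g P.b i (-(P.K : ℤ)) * (lev i + RW) ≤ (1 - θ₀ * ε₀) * P.δ (n + 1))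
    -- AHEAD: cut schedule
    {kH : ℤ} {Vtop : ℝ} {G Ω : ℤ → ℝ} (hk₁ : (P.k₁ : ℤ) ≤ kH + 2) (hk₁1 : 1 ≤ P.k₁) (hkH : 0 ≤ kH) (hVtop : 0 ≤ Vtop) (hG0 : ∀ j, kH < j → 0 ≤ G j)
    (hGpos : 0 < G (kH + 1))
    (hΩ : ∀ j, kH < j → ∀ N : Finset ℤ, (∀ m ∈ N, j < m) → ∑ m ∈ N, (w m)⁻¹ ^ 2 ≤ Ω j)
    (hGΩ : ∀ j, kH < j → 2 * (9 / 8 * r) ^ 2 * Ω j ≤ G j ^ 2)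
    (hclose0 : 4 / 3 * c₀ * clock ε₀ (kH + 1) * Vtop * (Vtop + 2 * ε * G (kH + 1)) < G (kH + 1))
    (hcloseG : ∀ j, kH + 1 ≤ j →
      4 / 3 * c₀ * clock ε₀ (j + 1) * (2 * G j) * (2 * G j + 2 * ε * G (j + 1)) < G (j + 1))
    (hGr : ∀ k, kH < k → 8 * (w k * (2 * G k)) ≤ r * (1 - θ₀ * ε₀))
    -- THE CONDITIONAL CORE-BLOCK ENCLOSURE against the co-scaled pulse flow (E2, booked; block `[2−K, k_H+1]`), its profile and the
    -- reference rows read off the co-scaled pulse flow (carrier, hull, ahead window, window hulls)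
    {Dk MW : ℤ → ℝ}
    (hblock : ∀ z S₀ s S F, InTubeWith P (splitBcl P (behindR54 P θ' Wb) δs i₀ ustar) i₀ X₀ w r ζ ustar n z →
      (∀ i k, w k * |S₀ i k - z i k| ≤ r) → 0 < s →
      PseudoFlowOnShift shiftSetFlat s ε₀ (mirrorTable ε ε) 0 0 S₀ (fun i k => (1 / 2) * S₀ i k ^ 2) (fun _ _ => 0) S F →
        ∀ t ∈ Icc 0 c₀, t ≤ s →
          (∀ s' ∈ Icc 0 t, |(S - scaleFam (anchorScale P i₀ z) U) 0 (1 - (P.K : ℤ)) s'| ≤ 2 * RBAR ∧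
              |(S - scaleFam (anchorScale P i₀ z) U) 1 (1 - (P.K : ℤ)) s'| ≤ 2 * BBAR ∧
              ∀ i : Fin 2, |S i (kH + 1 + 1) s'| ≤ 4 * G (kH + 1)) →
            ∀ s' ∈ Icc 0 t, ∀ (i : Fin 2) (k : ℤ), 2 - (P.K : ℤ) ≤ k → k ≤ kH + 1 →
              |(S - scaleFam (anchorScale P i₀ z) U) i k s'| ≤ Dk k)
    (hρD : Dk (2 - (P.K : ℤ)) ≤ RHO2)
    (hrefC : ∀ z, InTubeWith P (splitBcl P (behindR54 P θ' Wb) δs i₀ ustar) i₀ X₀ w r ζ ustar n z → ∀ t ∈ Icc tlo c₀,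
      P.Astar * (1 - P.γ (n + 1)) * (1 + ε₀) ^ (-θ₀) + Dk 1 ≤ |scaleFam (anchorScale P i₀ z) U i₀ 1 t|)
    (hrefV : ∀ z, InTubeWith P (splitBcl P (behindR54 P θ' Wb) δs i₀ ustar) i₀ X₀ w r ζ ustar n z → ∀ s ∈ Icc 0 c₀,
      |scaleFam (anchorScale P i₀ z) U 1 (kH + 1) s| + Dk (kH + 1) ≤ Vtop)
    (hrefA : ∀ z, InTubeWith P (splitBcl P (behindR54 P θ' Wb) δs i₀ ustar) i₀ X₀ w r ζ ustar n z → ∀ t ∈ Icc 0 c₀,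
      ∀ (i : Fin 2) (k : ℤ), (P.k₁ : ℤ) ≤ k → k ≤ kH →
        8 * (w k * (|scaleFam (anchorScale P i₀ z) U i (1 + k) t| + Dk (1 + k))) ≤ r * (1 - θ₀ * ε₀))
    (hMW : ∀ z, InTubeWith P (splitBcl P (behindR54 P θ' Wb) δs i₀ ustar) i₀ X₀ w r ζ ustar n z → ∀ s ∈ Icc 0 c₀,
      ∀ (i : Fin 2) (k : ℤ), 2 - (P.K : ℤ) ≤ k → k ≤ kH + 1 → |scaleFam (anchorScale P i₀ z) U i k s| ≤ MW k)
    -- ENVELOPE: window levels and the four rows against `env₀`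
    {env₀ Hk : ℤ → ℝ} (hHkW : ∀ k : ℤ, 2 - (P.K : ℤ) ≤ k → k ≤ kH + 1 → MW k + Dk k ≤ Hk k)
    (henvB : ∀ k : ℤ, k ≤ -(P.K : ℤ) →
      Real.exp (θ' * ((1 : ℝ) - P.K - k)) * (V₀B + A₁ * A₀ * (A₁ + ε * A₀) * c₀) ≤ env₀ k)
    (henvI : (1 / 2) * (M + rI) ^ 2 ≤ env₀ (1 - (P.K : ℤ)))
    (henvW : ∀ k : ℤ, 2 - (P.K : ℤ) ≤ k → k ≤ kH + 1 → (1 / 2) * Hk k ^ 2 ≤ env₀ k)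
    (henvA : ∀ m : ℤ, kH + 1 < m → 2 * G (m - 1) ^ 2 ≤ env₀ m) :
    TubeStepClockWith P (splitBcl P (behindR54 P θ' Wb) δs i₀ ustar) (choiceRule P i₀ ε₀ θ₀ t₀ good) shiftSetFlat σ ε₀ i₀
        (mirrorTable ε ε) X₀ w r θ₀ c₀ ζ ustar n ∧
      TubeStepEnvelopeWith P (splitBcl P (behindR54 P θ' Wb) δs i₀ ustar) (choiceRule P i₀ ε₀ θ₀ t₀ good) shiftSetFlat ε₀ i₀
        (mirrorTable ε ε) X₀ w r c₀ env₀ ζ ustar n ∧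
      TubeStepLandWith P (splitBcl P (behindR54 P θ' Wb) δs i₀ ustar) (choiceRule P i₀ ε₀ θ₀ t₀ good) shiftSetFlat ε₀ i₀
        (mirrorTable ε ε) X₀ w r c₀ ζ ustar n := by
  have hε₀' : (-1 : ℝ) < ε₀ := neg_one_lt_zero.trans hε₀
  have hBcl := splitBcl_fst P (behindR54 P θ' Wb) δs i₀ ustar
  have hKH : 2 - (P.K : ℤ) ≤ kH + 1 := by omega
  -- the tube at hop `n > N₀`: anchor band ⇒ `0 < x_z ≤ 1`
  have hx : ∀ z, InTubeWith P (splitBcl P (behindR54 P θ' Wb) δs i₀ ustar) i₀ X₀ w r ζ ustar n z →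
      0 < anchorScale P i₀ z ∧ anchorScale P i₀ z ≤ 1 := by
    intro z hz
    have h0 : n ≠ 0 := by omega
    have h1 : ¬ n ≤ P.N₀ := by omega
    simp only [InTubeWith, h0, if_false, h1] at hz
    exact ⟨anchorScale_pos_of_anchorClause P hAstar hγn hz.1, anchorScale_le_one_of_anchorClause P hAstar hz.1⟩
  -- (α): the co-scaled pulse flow is an exact zero-slack flow on `[0, c₀]` from `x_z·u⋆`
  have hWflow : ∀ z, InTubeWith P (splitBcl P (behindR54 P θ' Wb) δs i₀ ustar) i₀ X₀ w r ζ ustar n z →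
      PseudoFlowOnShift shiftSetFlat c₀ ε₀ (mirrorTable ε ε) 0 0 (fun i k => anchorScale P i₀ z * ustar i k)
        (fun i k => (1 / 2) * (anchorScale P i₀ z * ustar i k) ^ 2) (fun _ _ => 0) (scaleFam (anchorScale P i₀ z) U)
        (fun i k t => (1 / 2) * scaleFam (anchorScale P i₀ z) U i k t ^ 2) := fun z hz =>
    coScaled_pseudoFlowOnShift hU hε₀'.le hc₀ hc₀U (hx z hz).1 (hx z hz).2
  have hM : ∀ z, InTubeWith P (splitBcl P (behindR54 P θ' Wb) δs i₀ ustar) i₀ X₀ w r ζ ustar n z →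
      ∀ s ∈ Icc 0 c₀, ∀ i, ∀ m ∈ Finset.Icc (-(P.D : ℤ)) (1 - (P.K : ℤ)), |scaleFam (anchorScale P i₀ z) U i m s| ≤ M :=
    fun z hz s hs i m hm => abs_scaleFam_le (fun s' hs' => hMU s' hs' i m hm) (hx z hz).1.le (hx z hz).2 s hs
  have hM₁ : ∀ z, InTubeWith P (splitBcl P (behindR54 P θ' Wb) δs i₀ ustar) i₀ X₀ w r ζ ustar n z →
      ∀ s ∈ Icc 0 c₀, |scaleFam (anchorScale P i₀ z) U 1 (-(P.K : ℤ)) s| ≤ M₁ :=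
    fun z hz => abs_scaleFam_le hM₁U (hx z hz).1.le (hx z hz).2
  have hM₂ : ∀ z, InTubeWith P (splitBcl P (behindR54 P θ' Wb) δs i₀ ustar) i₀ X₀ w r ζ ustar n z →
      ∀ s ∈ Icc 0 c₀, |scaleFam (anchorScale P i₀ z) U 0 (2 - (P.K : ℤ)) s| ≤ M₂ :=
    fun z hz => abs_scaleFam_le hM₂U (hx z hz).1.le (hx z hz).2
  have h0c : (0 : ℝ) ∈ Icc 0 c₀ := ⟨le_rfl, hc₀.le⟩
  have hM0 : 0 ≤ M :=
    (abs_nonneg _).trans (hMU 0 h0c 0 (1 - (P.K : ℤ)) (by simp only [Finset.mem_Icc]; omega))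
  have hM₂0 : 0 ≤ M₂ := (abs_nonneg _).trans (hM₂U 0 h0c)
  have hEW : ∀ z, InTubeWith P (splitBcl P (behindR54 P θ' Wb) δs i₀ ustar) i₀ X₀ w r ζ ustar n z →
      coMovingEnergyOn (Finset.Icc (1 - (P.D : ℤ)) (-(P.K : ℤ))) P.θV (-(P.K : ℝ))
        (fun i k _ => anchorScale P i₀ z * ustar i k - (fun i k => anchorScale P i₀ z * ustar i k) i k) 0 ≤ 0 :=
    fun z _ => (coScaled_start_mismatch_eq_zero P i₀ ustar z _ _ _).le
  have hV₀Ndef' : V₀N = (Real.sqrt (P.v n + (P.δ n / ωK) ^ 2) + Real.sqrt P.D * r + Real.sqrt 0) ^ 2 := by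
    rw [Real.sqrt_zero, add_zero]; exact hV₀Ndef
  -- the section datum, along every kick-ball flow of any horizon
  have hsecG : ∀ z S₀ s S F, InTubeWith P (splitBcl P (behindR54 P θ' Wb) δs i₀ ustar) i₀ X₀ w r ζ ustar n z →
      (∀ i k, w k * |S₀ i k - z i k| ≤ r) → 0 < s →
      PseudoFlowOnShift shiftSetFlat s ε₀ (mirrorTable ε ε) 0 0 S₀ (fun i k => (1 / 2) * S₀ i k ^ 2) (fun _ _ => 0) S F →
        ∀ i, |(S - scaleFam (anchorScale P i₀ z) U) i (1 - (P.K : ℤ)) 0| ≤ rs :=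
    fun z S₀ s S F hz hkick _ hS => interfaceStart_le_coScaled (θ' := θ') (Wb := Wb) (i₀ := i₀) (X₀ := X₀) (c₀ := s) (ζ := ζ)
      P hU hn hw1 hω₁ hω₁le hrs z S₀ s S F ⟨hz, hkick, le_rfl, hS⟩
  have hsec : ∀ z S₀ τ S F, HopPremiseWith P (splitBcl P (behindR54 P θ' Wb) δs i₀ ustar) shiftSetFlat ε₀ i₀ (mirrorTable ε ε)
      X₀ w r c₀ ζ ustar n z S₀ τ S F → ∀ i, |(S - scaleFam (anchorScale P i₀ z) U) i (1 - (P.K : ℤ)) 0| ≤ rs :=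
    fun z S₀ τ S F h => hsecG z S₀ τ S F h.1 h.2.1 (hc₀.trans_le h.2.2.1) h.2.2.2
  have hwin' : ∀ z S₀ τ S F, HopPremiseWith P (splitBcl P (behindR54 P θ' Wb) δs i₀ ustar) shiftSetFlat ε₀ i₀ (mirrorTable ε ε)
      X₀ w r c₀ ζ ustar n z S₀ τ S F → ∀ t, good n S t → 0 < t ∧ t ≤ c₀ := fun z S₀ τ S F h t ht =>
    ⟨htlo.trans_le (hwin z S₀ τ S F h t ht).1, (hwin z S₀ τ S F h t ht).2⟩
  -- THE BLOCK: unconditional rows from the conditional enclosure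
  obtain ⟨hcore2, hwinA, hVt, -⟩ := tubeRows_of_conditionalBlock P hBcl hWflow le_rfl hε hε₀ hn hK hDK hθV hθ hθ5 hw1 hr0 hc₀
    hk₁1 hAstar hωK hωKle hMuK hWbn hAeff hM0 hM hM₁ hM₂0 hM₂ hEW hρ0 hRB0 hBB0 hRr hBr hVN0 hI₁0 hI₂0 hI₁
    hI₂ hPUMPdef hlevC hlevV hAdef hA₀def hA₁def hrA hA₀le hV₀Ndef' hV₀Bdef hENdef hμN hμNle hμB hμBle hlevN hlevB hclose hsecG
    hwin' hKH hk₁ hGpos hVtop hblock hρD hrefV hΩ hGΩ hclose0 hrefA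
  -- the block deviation along every premise on `[0, c₀]` (for the carrier and the window hulls)
  have hIN : ∀ z S₀ τ S F, HopPremiseWith P (splitBcl P (behindR54 P θ' Wb) δs i₀ ustar) shiftSetFlat ε₀ i₀ (mirrorTable ε ε)
      X₀ w r c₀ ζ ustar n z S₀ τ S F → ∀ s ∈ Icc 0 c₀, ∀ (i : Fin 2) (k : ℤ), 2 - (P.K : ℤ) ≤ k → k ≤ kH + 1 →
        |(S - scaleFam (anchorScale P i₀ z) U) i k s| ≤ Dk k := by
    intro z S₀ τ S F hprem
    have hz := hprem.1
    have hkick := hprem.2.1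
    have hw0 : ∀ k, 0 < w k := fun k => lt_of_lt_of_le one_pos (hw1 k)
    have hz' := hz
    have h0 : n ≠ 0 := by omega
    have h1 : ¬ n ≤ P.N₀ := by omega
    simp only [InTubeWith, h0, if_false, h1] at hz'
    obtain ⟨-, -, -, -, hA⟩ := hz'
    have hinit : ∀ N : Finset ℤ, (∀ m ∈ N, kH + 1 < m) → ∑ m ∈ N, ∑ i : Fin 2, S₀ i m ^ 2 ≤ G (kH + 1) ^ 2 :=
      fun N hN => (initialTail_le_of_clauses P hw0 hr0 hA hkick (j := kH + 1) (by omega) hN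
        (hΩ (kH + 1) (by omega) N hN)).trans (hGΩ (kH + 1) (by omega))
    exact fun s hs => (tubeBlock_closure P hBcl hWflow le_rfl hε hε₀ hn hK hDK hθV hθ hθ5 hw1 hr0 hc₀ hAstar hωK hωKle hMuK hWbn
      hAeff hM0 hM hM₁ hM₂0 hM₂ hEW hρ0 hRB0 hBB0 hRr hBr hVN0 hI₁0 hI₂0 hI₁ hI₂ hPUMPdef hlevC hlevV hAdef hA₀def hA₁def hrA
      hA₀le hV₀Ndef' hV₀Bdef hENdef hμN hμNle hμB hμBle hlevN hlevB hclose hz hkick hprem.2.2.2 hc₀ hprem.2.2.1 le_rfl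
      (hsec z S₀ τ S F hprem) hKH hGpos hVtop
      (fun t ht => hblock z S₀ τ S F hz hkick (hc₀.trans_le hprem.2.2.1) hprem.2.2.2 t ht (ht.2.trans hprem.2.2.1)) hρD
      (hrefV z hz) hinit hclose0 s hs).1
  have hcarrier : ∀ z S₀ τ S F, HopPremiseWith P (splitBcl P (behindR54 P θ' Wb) δs i₀ ustar) shiftSetFlat ε₀ i₀
      (mirrorTable ε ε) X₀ w r c₀ ζ ustar n z S₀ τ S F → ∀ t, good n S t →
        P.Astar * (1 - P.γ (n + 1)) * (1 + ε₀) ^ (-θ₀) ≤ |S i₀ 1 t| := by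
    intro z S₀ τ S F hprem t ht
    obtain ⟨h1, h2⟩ := hwin z S₀ τ S F hprem t ht
    have hd := hIN z S₀ τ S F hprem t ⟨htlo.le.trans h1, h2⟩ i₀ 1 (by omega) (by omega)
    have e : (S - scaleFam (anchorScale P i₀ z) U) i₀ 1 t = S i₀ 1 t - scaleFam (anchorScale P i₀ z) U i₀ 1 t := rfl
    rw [e] at hd
    have h3 := abs_sub_abs_le_abs_sub (scaleFam (anchorScale P i₀ z) U i₀ 1 t) (S i₀ 1 t)
    rw [abs_sub_comm] at h3
    linarith only [hd, h3, hrefC z hprem.1 t ⟨h1, h2⟩]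
  have hhull : ∀ z S₀ τ S F, HopPremiseWith P (splitBcl P (behindR54 P θ' Wb) δs i₀ ustar) shiftSetFlat ε₀ i₀ (mirrorTable ε ε) X₀
      w r c₀ ζ ustar n z S₀ τ S F → ∀ t, good n S t → ∀ s ∈ Icc 0 t, ∀ (i : Fin 2) (k : ℤ), 2 - (P.K : ℤ) ≤ k → k ≤ kH + 1 →
        |S i k s| ≤ Hk k := by
    intro z S₀ τ S F hprem t ht s hs i k hk1 hk2
    obtain ⟨-, h2⟩ := hwin z S₀ τ S F hprem t ht
    have hsI : s ∈ Icc 0 c₀ := ⟨hs.1, hs.2.trans h2⟩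
    have hd := hIN z S₀ τ S F hprem s hsI i k hk1 hk2
    have e : (S - scaleFam (anchorScale P i₀ z) U) i k s = S i k s - scaleFam (anchorScale P i₀ z) U i k s := rfl
    rw [e] at hd
    have h3 := abs_sub_abs_le_abs_sub (S i k s) (scaleFam (anchorScale P i₀ z) U i k s)
    linarith only [hd, h3, hMW z hprem.1 s hsI i k hk1 hk2, hHkW k hk1 hk2]
  exact tubeStep_of_schedule_split P hU hc₀ hc₀U hMU hM₁U hM₂U hε hε₀ hn hK hDK hθV hθ hθ5 hw1 hr0 hAstar hg hb hωK hωKle hMuK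
    hω₁ hω₁le hWbn hWbn1 hvn1 hδn1 hγn hγ hθ₀ hθ₀1 hAFL hσ hσγ htlo hex hwin hcarrier hAeff hrs hρ0 hcore2 hRB0.le hBB0.le hRr
    hBr hVN0 hI₁0 hI₂0 hI₁ hI₂ hPUMPdef hlevC hlevV hRT hAdef hA₀def hA₁def hrA hA₀le hV₀Ndef hV₀Bdef hENdef hμN hμNle hμB hμBle
    hlevN hlevB hclose hbudgetN hbudgetB hlev0 hlev1 hland hδs hle hcoreland hRW hwake hk₁ hVtop hG0 hwinA hVt hΩ hGΩ hclose0
    hcloseG hGr hhull henvB henvI henvW henvA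

end Step

end Summit.NavierStokesRegularity.NavierStokesRegularity.Theorems.HopTube

end
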